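import Mathlib
import HarnessLib
import Summits.ValiantsHypothesis.ValiantsHypothesis.Theses.MonotoneRestoration
import Literature.Computability.AlgebraicComplexity.ArithCircuit
import Literature.Computability.AlgebraicComplexity.ArithCircuitProofs
import Literature.Computability.AlgebraicComplexity.MonotoneStructure
import Literature.Computability.AlgebraicComplexity.PermanentIrreducible
import Literature.ModelTheory.FiniteModelTheory.CkEquiv
import Summits.ValiantsHypothesis.ValiantsHypothesis.Theorems.MonotoneRestorationMonotoneRestorationQPCosetCount
import Summits.ValiantsHypothesis.ValiantsHypothesis.Theorems.MonotoneRestorationMonotoneRestorationQPSymmetricLB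
import Summits.ValiantsHypothesis.ValiantsHypothesis.Theorems.MonotoneRestorationMonotoneRestorationQPSupportSymmetrisation
import Summits.ValiantsHypothesis.ValiantsHypothesis.Theorems.MonotoneRestorationMonotoneRestorationQPSparseRegime
import Summits.ValiantsHypothesis.ValiantsHypothesis.Theorems.MonotoneRestorationMonotoneRestorationQPBeta
import Literature.Computability.AlgebraicComplexity.SymmetricArithCircuit
import Literature.Computability.AlgebraicComplexity.DawarWilsenach2025Proofs
import Literature.GroupTheory.PermutationGroups.SmallIndexSubgroups
import Summits.ValiantsHypothesis.ValiantsHypothesis.Theorems.MonotoneRestorationQP.Negative.LoadBearing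
import Summits.ValiantsHypothesis.ValiantsHypothesis.Theorems.MonotoneRestorationMonotoneRestorationQPPermSupportCount
import Summits.ValiantsHypothesis.ValiantsHypothesis.Theorems.MonotoneRestorationMonotoneRestorationQPDelta

/-! TTRL-lite variant V20247 of stmt-ValiantsHypothesis-15886 -/

-- `ValiantsHypothesis.ValiantsHypothesis`: the D-0017 layout repeats the problem name in the path.
set_option linter.dupNamespace false

namespace Summit.ValiantsHypothesis.ValiantsHypothesis.Theorems

open Summit.ValiantsHypothesis.ValiantsHypothesis.Theses.MonotoneRestoration
open Literature.Computability.AlgebraicComplexity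

/-- Size bookkeeping for variant V20247: `(n + n/2 + 7)^24 ≤ (n + 2)^72`. [folklore] -/
theorem stub_esymmRowSums_complexity_var20247_size (n : ℕ) :
    (n + n / 2 + 7) ^ 24 ≤ (n + 2) ^ 72 := by
  have h : n + n / 2 + 7 ≤ (n + 2) ^ 3 := by
    have h3 : (n + 2) ^ 3 = n ^ 3 + 6 * n ^ 2 + 12 * n + 8 := by ring
    rw [h3]; omega
  calc (n + n / 2 + 7) ^ 24 ≤ ((n + 2) ^ 3) ^ 24 := Nat.pow_le_pow_left h 24
    _ = (n + 2) ^ 72 := by rw [← pow_mul]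

/-- **TTRL-lite variant V20247** (contrast corner symmetric/`ℂ` of `stub_esymmRowSums_complexity`):
`e_{⌊n/2⌋}` of the row sums `R_i = Σ_j x_ij` has, for every `n`, a `Sym_n`-symmetric labelled
arithmetic circuit over `ℂ` with at most `(n + 2)^72` gates — an instance of the landed
`esymmRowSums_symmetric_circuit n (n/2)` (THEOREM δ, `…QPDelta.lean`, size `(n + n/2 + 7)^24`).
[new] -/
theorem stub_esymmRowSums_complexity_var20247 :
    ∃ c₀ : ℕ, ∀ n : ℕ, ∃ (G : Type) (_ : Fintype G)
      (C : LabelledArithCircuit ℂ (Fin n × Fin n) Unit G),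
      C.IsSymmetric (Equiv.Perm (Fin n)) ∧
      C.eval (C.output ()) = MvPolynomial.bind₁ (fun i : Fin n => ∑ j : Fin n, MvPolynomial.X (i, j))
        (MvPolynomial.esymm (Fin n) ℂ (n / 2)) ∧
      Fintype.card G ≤ (n + 2) ^ c₀ := by
  refine ⟨72, fun n => ?_⟩
  obtain ⟨G, hG, C, hCs, hCe, hCc⟩ := esymmRowSums_symmetric_circuit n (n / 2)
  exact ⟨G, hG, C, hCs, hCe, hCc.trans (stub_esymmRowSums_complexity_var20247_size n)⟩

end Summit.ValiantsHypothesis.ValiantsHypothesis.Theorems
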